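/-
Copyright: the b2b-balaban cell (near-miss cell 7), T⁴-continuum fan-out; row NE7b ROUND-2 swarm, seat
t4-ne7b-formalise-leaf-03 (row S12 «ASSEMBLY» of `t4/b2b-balaban-t4-ne7b-p1/LEAVES-NE7b.md`; node A12 of the typer's
`t4/formal/NE7b/DAG.md`).  Released under the licence of the surrounding project.
-/
import Summits.QuantumFields.BalabanUV.T4Continuum.Support.HistoryAssemblyTerms
import Summits.QuantumFields.BalabanUV.T4Continuum.Support.CountThresholdShapeFree

/-!
# History assembly over the SHAPE-FREE infrared threshold (ruling R-OWNER-22-11)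

Summits-side support file of the T⁴-continuum cell (rung (B)+1 on a FINITE torus only; NOT infinite volume, NOT the
mass gap, NOT the Clay statement; NOT a proof of the spine estimate NE7b).  Row S12 «ASSEMBLY» of the ROUND-2 swarm
table `t4/b2b-balaban-t4-ne7b-p1/LEAVES-NE7b.md`, node A12 of the typer's `t4/formal/NE7b/DAG.md`.

WHY.  The owner's quantifier-order point (journal l.6786, `CountThresholdShapeFree`): the named threshold
`CountThresholdExit.irThresholdTH sh C L r β₀ D` of the tree-slot exit is `Classical.choose` of an existential stated PER
SHAPE MAP `sh : ε → PEv`, hence formally a function of the tag type; the T⁴ prefix «∃ g₁ > 0, ∀ g ≤ g₁, ∀ tuned g₀, ∀ K,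
∀ terms ∕ histories (whatever their tags)» wants the infrared threshold fixed BEFORE the tags.  The shape-free threshold
`CountThresholdShapeFree.irThresholdH C L r β₀ D` (constants + horizon only) with the exit
`relWeightBound_lateMergers_of_irThresholdH` (conclusion verbatim) repairs this; ruling R-OWNER-22-11 asks the assembly
to switch its ONE binder `hir` to it.  The two thresholds are opaque `Classical.choose` witnesses, so no inequality
between them is provable and the switch is a re-composition, not a one-line corollary: this file re-runs the two
compositions of `HistoryAssemblyTrees` §3 and `HistoryAssemblyTerms` §4 VERBATIM over the shape-free exit.

WHAT.  §1 **`hybridNE7_of_treeBinders_canonH`** = `HistoryAssemblyTrees.hybridNE7_of_treeBinders_canon` with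
`hir : irThresholdH C F.L rr β₀ 0 ≤ log g⁻²` (NO `sh`); §2 **`hybridNE7_of_termReading_canonH`** =
`HistoryAssemblyTerms.hybridNE7_of_termReading_canon` likewise.  Every other binder, every plugged input (typed flow
`HistoryFlow.flowBinders_of_tuned`, cells `HistoryTables.cellN`, matching scale `jhalf`, rates `treeRates_of_large`,
`HistoryRegeneration.regeneration_pair_of_cor3With`, the term reading `TermReading` and its derived tree-slot binders)
and the conclusion are byte-identical to the originals.  The pedigree ∕ printed-price ENDs over these follow in
`HistoryAssemblyShapeFreeEnd`.  [folklore] composition of landed lemmas by name; no new definition, no `[cite:]` tag,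
nothing printed asserted.

HONEST DEPENDENCY (cell): continuum YM on T⁴ ⇐ BetaPertH ∧ nine spine estimates (0/9 proved); BetaPertH ⇐ (D1) ∧ (D4)
∧ CAP+tail.  Nothing of H3 ∕ (B) ∕ BetaPertH is discharged here; NE7b is NOT proved; no date.
-/

open Finset MeasureTheory
open Literature.MathematicalPhysics.QuantumFieldTheory.Balaban1983to89
open T4PersistenceDictionary T4PersistentHistoryCount T4BankedInduction T4PrintedShapeBanking
open T4WeightBudget T4GlobalDenominator T4LiveClassFibration T4LiveStructureGas T4LiveGasToTerms T4RecordPriceSeam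
open T4PartnerMultiplicity T4IndicatorShell T4MatchingAssembly T4MatchingClosure T4MatchingClosureSocket T4Continuum
open T4StabilitySocket T4BranchingRecordsGas T4TaggedShapeBanking T4CanonicalMenus T4RenewalChains
open Summit.QuantumFields.BalabanUV.T4Continuum.PlacementBatch
open Summit.QuantumFields.BalabanUV.T4Continuum.PlacementSkeleton
open Summit.QuantumFields.BalabanUV.T4Continuum.CountThresholdUniform
open Summit.QuantumFields.BalabanUV.T4Continuum.CountThresholdExit
open Summit.QuantumFields.BalabanUV.T4Continuum.CountSeamJunction
open Summit.QuantumFields.BalabanUV.T4Continuum.LateMergers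
open Summit.QuantumFields.BalabanUV.T4Continuum.HistoryFlow
open Summit.QuantumFields.BalabanUV.T4Continuum.HistoryRegeneration
open Summit.QuantumFields.BalabanUV.T4Continuum.HistoryTables
open Summit.QuantumFields.BalabanUV.T4Continuum.HistoryAssemblyTrees
open Summit.QuantumFields.BalabanUV.T4Continuum.HistorySocketTH
open Summit.QuantumFields.BalabanUV.T4Continuum.HistoryAssemblyTerms
open Summit.QuantumFields.BalabanUV.T4Continuum.CountThresholdShapeFree

namespace Summit.QuantumFields.BalabanUV.T4Continuum.HistoryAssemblyShapeFree

noncomputable section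

/-! ## §1 The plugged tree-slot exit at `D = 0`, shape-free threshold -/

section ExitLevel

variable {F : T4Family} {G : Type*} [GaugeGroup G] [MeasurableSpace G] [HaarData G] [RegularGaugeGroup G]
variable {ε : Type*} [DecidableEq ε]
variable {ι κc : Type*} [DecidableEq κc] [DecidableEq ι] {l₀ vol : ℝ} {K₀ : ℕ} {π : ℕ → ι → κc}
  {T : ℕ → Finset ι} {A A' shA shB : ℕ → ℝ → ι → ℝ} {Bad' : ℕ → ℝ → Finset κc} {dead dead' : ℕ → ℝ → ι → ℝ}
  {Fc Rf Fc' Rf' : ℕ → κc → ℝ} {nup mup : ℕ → ℝ → ℝ} {Nup : ℝ}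
  {Cc Rr CcRec RrRec : ℕ → ℝ → ι → ℝ} {ν u s₂ q₀ r s Wsh : ℕ → ℝ}

/-- **NE7b's COUNT EXIT OVER TREE SLOTS, ALL KERNEL-ABLE BINDERS PLUGGED — SHAPE-FREE THRESHOLD** (R-OWNER-22-11):
`HistoryAssemblyTrees.hybridNE7_of_treeBinders_canon` VERBATIM except `hir : irThresholdH C F.L rr β₀ 0 ≤ log g⁻²` (no `sh`), i.e.
`CountThresholdShapeFree.relWeightBound_lateMergers_of_irThresholdH` at horizon `D = 0`, `Δ = 1` (the plain tree-slot count: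
`ConsistentTH … 0 ↔ ConsistentT`, `padW W 0 = W`) along the TUNED runs `D.C ⟨K, F.m, g₀ K⟩`, with the typed flow
(`HistoryFlow.flowBinders_of_tuned`, run clamped at the cutoff for the profile binder), cells `cellN d n F.L`, matching
scale `jhalf`, rates at `η̄₊ = log 2` (`treeRates_of_large`) and the two `Regeneration` runs
(`HistoryRegeneration.regeneration_pair_of_cor3With`) plugged, then `CountSeamJunction.hybridNE7_of_eventually`.
Displayed: constants (+ two largeness conditions), flow, tuning, `irThresholdH C F.L rr β₀ 0 ≤ log g⁻²`, (2.5) side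
condition, (B) side, H3 numerator readings, the four TREE-SLOT (ID) binders (labelled price on THE tagged genealogy of
the slot), the seam data.  Weight: `constOf … · recordsBudget (birthMass C) κ₁ n^d L^d (log 2) jhalf`. [folklore] -/
theorem hybridNE7_of_treeBinders_canonH (D : FiniteEpsData F G) (sh : ε → PEv) {C : T4PrintedShapeBanking.Consts}
    {rr : ℕ} {β₀ : ℝ} (h : ThresholdOK C F.L rr β₀) (hμ : 0 < C.μ) (d n : ℕ) (Dcap Ncap : ℕ → ℕ)
    -- two largeness conditions on the free bank constants
    (hκ₁ : (d : ℝ) * Real.log F.L + 2 * Real.log 2 ≤ C.κ₁) (hE₀ : Real.log (2 + birthMass C) ≤ C.E₀)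
    -- the flow side (⇐ BetaPertH, displayed) and tuning
    {γ₀ γb b β' : ℝ} {pe : ℕ} (hb : 0 ≤ b) (hlo : FlowStep.BetaLowerH b γ₀ D.βfun)
    (hhi : FlowStep.BetaUpperH β' γ₀ D.βfun) (hγ : γb ≤ γ₀) (hγβ : γb ^ 2 * β' < 1)
    (S : B14FlowStep.SmallnessFor γb β' β₀ F.L pe) (hp₀ : C.p₀ ≤ pe) (hrr : rr ≤ pe)
    {g : ℝ} {g₀ : ℕ → ℝ} (ht : D.Tuned γb g g₀)
    (hir : irThresholdH C F.L rr β₀ 0 ≤ Real.log (g ^ 2)⁻¹)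
    -- the (B) side
    (hsign : B16.SignConventions D.C) {γB : ℝ} {em ep : ℝ → ℝ} (hcor : B16.Cor3With D.C γB em ep) (hγB : γb ≤ γB)
    {obs : (K : ℕ) → GaugeField (F.P K) 0 G → ℝ} {B : ℝ}
    (hobs : ∀ K, Measurable (obs K)) (hbd : ∀ K U, |obs K U| ≤ B)
    (hα : ∀ K t, |t| ≤ l₀ → K₀ ≤ K →
      ∫ U, Real.exp (t * obs K U) * D.dens K (g₀ K) 0 U ∂fieldMeasure (F.P K) 0 G ≤ ∑ τ ∈ T K, A K t τ)
    (hα' : ∀ K t, |t| ≤ l₀ → K₀ ≤ K →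
      ∫ U, Real.exp (t * obs (K + 1) U) * D.dens (K + 1) (g₀ (K + 1)) 0 U ∂fieldMeasure (F.P (K + 1)) 0 G ≤
        ∑ τ ∈ T K, A' K t τ)
    {c₀ n₁ : ℝ} (hc₀ : 0 < c₀) (hfloor : ∀ K, K₀ ≤ K → c₀ ≤ smallFieldMass D K (g₀ K))
    (hfloor' : ∀ K, K₀ ≤ K → c₀ ≤ smallFieldMass D (K + 1) (g₀ (K + 1)))
    (hsites : ∀ K, K₀ ≤ K → ((D.C ⟨K, F.m, g₀ K⟩).numSites K : ℝ) ≤ n₁)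
    (hsites' : ∀ K, K₀ ≤ K → ((D.C ⟨K + 1, F.m, g₀ (K + 1)⟩).numSites (K + 1) : ℝ) ≤ n₁)
    (hNup : 0 ≤ Nup) (hnup : ∀ K t, |t| ≤ l₀ → K₀ ≤ K → 0 ≤ nup K t ∧ nup K t ≤ Nup)
    (hmup : ∀ K t, |t| ≤ l₀ → K₀ ≤ K → 0 ≤ mup K t ∧ mup K t ≤ Nup)
    -- H3: the displayed numerator reading of both runs over the ABSTRACT term family
    (bad_subset : ∀ K t, |t| ≤ l₀ → K₀ ≤ K → Bad' K t ⊆ classIndex π T K)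
    (up : ∀ K t, |t| ≤ l₀ → K₀ ≤ K → ∀ c ∈ Bad' K t, ∀ τ ∈ fibre π T K c, A K t τ ≤ dead K t τ * Fc K c * nup K t)
    (dead_nonneg : ∀ K t, |t| ≤ l₀ → K₀ ≤ K → ∀ c ∈ Bad' K t, ∀ τ ∈ fibre π T K c, 0 ≤ dead K t τ)
    (resum : ∀ K t, |t| ≤ l₀ → K₀ ≤ K → ∀ c ∈ Bad' K t, ∑ τ ∈ fibre π T K c, dead K t τ ≤ Rf K c)
    (F_nonneg : ∀ K t, |t| ≤ l₀ → K₀ ≤ K → ∀ c ∈ Bad' K t, 0 ≤ Fc K c)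
    (up' : ∀ K t, |t| ≤ l₀ → K₀ ≤ K → ∀ c ∈ Bad' K t, ∀ τ ∈ fibre π T K c,
      A' K t τ ≤ dead' K t τ * Fc' K c * mup K t)
    (dead'_nonneg : ∀ K t, |t| ≤ l₀ → K₀ ≤ K → ∀ c ∈ Bad' K t, ∀ τ ∈ fibre π T K c, 0 ≤ dead' K t τ)
    (resum' : ∀ K t, |t| ≤ l₀ → K₀ ≤ K → ∀ c ∈ Bad' K t, ∑ τ ∈ fibre π T K c, dead' K t τ ≤ Rf' K c)
    (F'_nonneg : ∀ K t, |t| ≤ l₀ → K₀ ≤ K → ∀ c ∈ Bad' K t, 0 ≤ Fc' K c)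
    -- the (2.5) side condition on the size function the (ID) data are built over
    (R : ℕ → ℕ → ℕ) (hR : ∀ K s, s ≤ K → B14.IsRj F.L rr ((D.C ⟨K, F.m, g₀ K⟩).flow.g s) (R K s))
    -- the four TREE-SLOT (ID) binders over the canonical cells and the canonical run family
    (y : ℕ → ℕ → (Fin d → ℕ) → Gen PEv → ℝ)
    (hy0 : ∀ K, ∀ j ≤ K, ∀ z ∈ cellN d n F.L K (K - j), ∀ Gs ∈ canonFam Dcap Ncap K j, 0 ≤ y K j z Gs)
    (hlabT : ∀ K, K₀ ≤ K → ∀ j ≤ K, ∀ z ∈ cellN d n F.L K (K - j), ∀ Gs ∈ canonFam Dcap Ncap K j,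
      y K j z Gs ≤ 0 ∨ ∃ G' : Gen ε, ConsistentT sh C K (R K) G' ∧ FreshT G' ∧
        K < G'.reach (dictWT sh (R K) C.n₁) ∧ relabel (shape ∘ sh) G' = Gs ∧
        y K j z Gs ≤ ((F.L : ℝ) ^ d) ^ partnerAges (PEv.step ∘ sh) G' *
          (Real.exp (-credits (credit C (D.C ⟨K, F.m, g₀ K⟩).flow.g ∘ sh) G') *
            Real.exp (lifeCost (dictWT sh (R K) C.n₁) (costT sh C K (R K)) G')))
    (str : ℕ → κc → Finset (BSlot (Fin d → ℕ) PEv))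
    (hinj : ∀ K t, |t| ≤ l₀ → K₀ ≤ K → Set.InjOn (str K) (Bad' K t))
    (hstr : ∀ K t, |t| ≤ l₀ → K₀ ≤ K → ∀ cl ∈ Bad' K t,
      str K cl ⊆ bliveSlots (cellN d n F.L) (canonFam Dcap Ncap) K ∧
        ∃ o ∈ boldSlots (cellN d n F.L) (canonFam Dcap Ncap) jhalf K, o ∈ str K cl)
    (hF : ∀ K t, |t| ≤ l₀ → K₀ ≤ K → ∀ cl ∈ Bad' K t, Fc K cl * Rf K cl ≤ famWeight (bslotPrice (y K)) (str K cl))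
    (hF' : ∀ K t, |t| ≤ l₀ → K₀ ≤ K → ∀ cl ∈ Bad' K t,
      Fc' K cl * Rf' K cl ≤ famWeight (bslotPrice (y K)) (str K cl))
    -- the seam's other inputs (NE7c socket, NE7 core budget, four summable rates)
    (hSh : ShellWeightBound l₀ T A A' shA shB Wsh)
    (hTB : ReindexedBudget l₀ vol T (fun K t τ => A K t τ - shA K t τ) (fun K t τ => A' K t τ - shB K t τ)
      (badOfClass π T Bad') Cc Rr CcRec RrRec ν u s₂ q₀ r s)
    (hr : Summable r) (hu : Summable u) (hs : Summable s) (hs₂ : Summable s₂) :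
    ∃ K₁ K₂, K₀ ≤ K₁ ∧ HybridNE7 l₀ vol (fun K => T (K₁ + (K₂ + K))) (fun K => A (K₁ + (K₂ + K)))
      (fun K => A' (K₁ + (K₂ + K))) (fun K => badOfClass π T Bad' (K₁ + (K₂ + K)))
      (fun K => constOf l₀ B (max (em g) 0) n₁ c₀ Nup *
        recordsBudget (birthMass C) C.κ₁ ((n : ℝ) ^ d) ((F.L : ℝ) ^ d) (Real.log 2) jhalf (K₁ + (K₂ + K)))
      (fun K => shA (K₁ + (K₂ + K))) (fun K => shB (K₁ + (K₂ + K))) (fun K => Wsh (K₁ + (K₂ + K)))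
      (fun K => (r (K₁ + (K₂ + K)) + u (K₁ + (K₂ + K))) + (s (K₁ + (K₂ + K)) + s₂ (K₁ + (K₂ + K)))) := by
  -- (i) the typed flow along the tuned runs (S8), clamped at the cutoff
  obtain ⟨h27, h29, hx1, -⟩ := flowBinders_of_tuned D hb hlo hhi hγ hγβ S hp₀ hrr ht R hR
  set gr : ℕ → ℕ → ℝ := fun K s => (D.C ⟨K, F.m, g₀ K⟩).flow.g (min s K) with hgr
  have h27' : ∀ K, K₀ ≤ K → B14.FlowIneq27 (gr K) β' β₀ C.p₀ K := fun K _ => flowIneq27_clamp (h27 K)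
  have h29' : ∀ K, K₀ ≤ K → B14FlowStep.FlowIneq29 (R K) (gr K) F.L β' β₀ K := fun K _ => flowIneq29_clamp (h29 K)
  have hR' : ∀ K, K₀ ≤ K → ∀ s, s ≤ K → B14.IsRj F.L rr (gr K s) (R K s) := by
    intro K _ s hs
    show B14.IsRj F.L rr ((D.C ⟨K, F.m, g₀ K⟩).flow.g (min s K)) (R K s)
    rw [min_eq_left hs]; exact hR K s hs
  have hx1' : ∀ K, K₀ ≤ K → ∀ s, s ≤ K → 1 ≤ Real.log ((gr K s) ^ 2)⁻¹ := by
    intro K _ s hs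
    show 1 ≤ Real.log (((D.C ⟨K, F.m, g₀ K⟩).flow.g (min s K)) ^ 2)⁻¹
    rw [min_eq_left hs]; exact hx1 K s hs
  have hir' : ∀ K, K₀ ≤ K → irThresholdH C F.L rr β₀ 0 ≤ Real.log ((gr K K) ^ 2)⁻¹ := by
    intro K _
    show _ ≤ Real.log (((D.C ⟨K, F.m, g₀ K⟩).flow.g (min K K)) ^ 2)⁻¹
    rw [min_self, (ht K).2]; exact hir
  have hP : ∀ K s, 0 ≤ p0Profile C.A₀ C.p₀ (gr K s) := fun K s =>
    p0Profile_nonneg_of_one_le_log C.p₀ h.A₀_pos.le (hx1 K (min s K) (min_le_right s K))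
  -- (iii) the two `Regeneration` runs with ONE constant (S11)
  obtain ⟨hA, hA'⟩ := regeneration_pair_of_cor3With D hsign hcor hγB ht hobs hbd hα hα' hc₀ hfloor hfloor' hsites
    hsites' hnup hmup bad_subset up dead_nonneg resum F_nonneg up' dead'_nonneg resum' F'_nonneg
  have hCn : 0 ≤ constOf l₀ B (max (em g) 0) n₁ c₀ Nup := constOf_nonneg hNup hc₀.le
  -- (ii) cells, matching scale, rates (S12 §1 + §2)
  have hL1 : 1 ≤ F.L := le_trans (by norm_num) (two_le_L F)
  have hLpos : (0 : ℝ) < F.L := by exact_mod_cast (lt_of_lt_of_le (by norm_num) hL1)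
  obtain ⟨hrate, h1, hx⟩ := treeRates_of_large hL1 d (birthMass_nonneg hμ) hκ₁ hE₀
  -- the labelled-price binder in the exit's `D = 0`, `Δ = 1` form, over the clamped run
  have hlab' : ∀ K, K₀ ≤ K → ∀ j ≤ K, ∀ z ∈ cellN d n F.L K (K - j), ∀ Gs ∈ canonFam Dcap Ncap K j,
      y K j z Gs ≤ 0 ∨ ∃ G' : Gen ε, ConsistentTH sh C K (R K) 0 G' ∧ FreshT G' ∧
        K - 0 < G'.reach (dictWT sh (R K) C.n₁) ∧ relabel (shape ∘ sh) G' = Gs ∧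
        y K j z Gs ≤ 1 * (((F.L : ℝ) ^ d) ^ partnerAges (PEv.step ∘ sh) G' *
          (Real.exp (-credits (credit C (gr K) ∘ sh) G') *
            Real.exp (lifeCost (padW (dictWT sh (R K) C.n₁) 0) (costT sh C K (R K)) G'))) := by
    intro K hK j hj z hz Gs hGs
    rcases hlabT K hK j hj z hz Gs hGs with h0 | ⟨G', hc, hf, hreach, hrel, hy⟩
    · exact Or.inl h0
    · refine Or.inr ⟨G', consistentTH_zero_iff.2 hc, hf, by simpa using hreach, hrel, ?_⟩
      rw [one_mul, padW_zero, credits_clamp sh C _ hc]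
      exact hy
  have hmain := relWeightBound_lateMergers_of_irThresholdH sh h hμ (cellN d n F.L) (V := (n : ℝ) ^ d)
    (Λ := (F.L : ℝ) ^ d) (by positivity) (pow_pos hLpos d) (card_cellN_le d n hL1) Dcap Ncap jhalf jhalf_le
    (c := 1 / 2) (by norm_num) half_le_sub_jhalf 0 (Δ := 1) le_rfl hA hA' hCn R gr (fun _ => β') h27' h29' hR' hx1'
    hir' hP (Real.log_nonneg one_le_two) hrate (pow_nonneg hLpos.le d) h1 hx y hy0 hlab' str hinj hstr hF hF'
  have e0 : (1 : ℝ) * Real.exp (C.κ₁ * ((0 : ℕ) : ℝ)) * birthMass C = birthMass C := by simp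
  rw [e0] at hmain
  exact hybridNE7_of_eventually hmain hSh hTB hr hu hs hs₂

end ExitLevel

/-! ## §2 The exit ∘ seam with the term reading plugged, shape-free threshold -/

section End

variable {F : T4Family} {G : Type*} [GaugeGroup G] [MeasurableSpace G] [HaarData G] [RegularGaugeGroup G]
variable {ε : Type*} [DecidableEq ε]
variable {ι : Type*} [DecidableEq ι] {l₀ vol : ℝ} {K₀ : ℕ} {T : ℕ → Finset ι} {A A' shA shB : ℕ → ℝ → ι → ℝ}
  {dead dead' : ℕ → ℝ → ι → ℝ} {nup mup : ℕ → ℝ → ℝ} {Nup : ℝ}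
  {Cc Rr CcRec RrRec : ℕ → ℝ → ι → ℝ} {ν u s₂ q₀ r s Wsh : ℕ → ℝ}

/-- **NE7b's COUNT EXIT WITH THE LIVE STRUCTURES READ PER TERM — SHAPE-FREE THRESHOLD** (R-OWNER-22-11):
`HistoryAssemblyTerms.hybridNE7_of_termReading_canon` VERBATIM except `hir : irThresholdH C F.L rr β₀ 0 ≤ log g⁻²`; i.e. §1's
`hybridNE7_of_treeBinders_canonH` (the tree-slot exit at `D = 0`, `Δ = 1` along the tuned runs, with typed flow, cells, matching scale, rates and both
`Regeneration` runs plugged) with: the live-class map `π K τ := bstrOf sh mem K τ` (the bslot family of the term's live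
members), the bad classes `badClasses sh mem jhalf T K` (an OLD member), `bad_subset` PROVED, the labelled price `yT` and
the slot families `str K c := c` DEFINED, and the four tree-slot binders PROVED from the displayed per-term reading:
`TermReading …` (per-member facts, within-term injectivity) and the per-term price readings `hprice`∕`hprice′`.  Still
displayed: constants (+ two largeness conditions), flow side (⇐ BetaPertH), tuning, `irThresholdH … 0 ≤ log g⁻²`, the
(2.5) side condition, the (B) side, the `Regeneration` numerator fields `up`∕`dead_nonneg`∕`resum`∕`F_nonneg` per run
over the defined classes, the seam data. [folklore] -/
theorem hybridNE7_of_termReading_canonH (D : FiniteEpsData F G) (sh : ε → PEv) {C : T4PrintedShapeBanking.Consts}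
    {rr : ℕ} {β₀ : ℝ} (h : ThresholdOK C F.L rr β₀) (hμ : 0 < C.μ) (d n : ℕ) (Dcap Ncap : ℕ → ℕ)
    (hκ₁ : (d : ℝ) * Real.log F.L + 2 * Real.log 2 ≤ C.κ₁) (hE₀ : Real.log (2 + birthMass C) ≤ C.E₀)
    -- the flow side (⇐ BetaPertH, displayed) and tuning
    {γ₀ γb b β' : ℝ} {pe : ℕ} (hb : 0 ≤ b) (hlo : FlowStep.BetaLowerH b γ₀ D.βfun)
    (hhi : FlowStep.BetaUpperH β' γ₀ D.βfun) (hγ : γb ≤ γ₀) (hγβ : γb ^ 2 * β' < 1)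
    (S : B14FlowStep.SmallnessFor γb β' β₀ F.L pe) (hp₀ : C.p₀ ≤ pe) (hrr : rr ≤ pe)
    {g : ℝ} {g₀ : ℕ → ℝ} (ht : D.Tuned γb g g₀)
    (hir : irThresholdH C F.L rr β₀ 0 ≤ Real.log (g ^ 2)⁻¹)
    -- the (B) side
    (hsign : B16.SignConventions D.C) {γB : ℝ} {em ep : ℝ → ℝ} (hcor : B16.Cor3With D.C γB em ep) (hγB : γb ≤ γB)
    {obs : (K : ℕ) → GaugeField (F.P K) 0 G → ℝ} {B : ℝ}
    (hobs : ∀ K, Measurable (obs K)) (hbd : ∀ K U, |obs K U| ≤ B)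
    (hα : ∀ K t, |t| ≤ l₀ → K₀ ≤ K →
      ∫ U, Real.exp (t * obs K U) * D.dens K (g₀ K) 0 U ∂fieldMeasure (F.P K) 0 G ≤ ∑ τ ∈ T K, A K t τ)
    (hα' : ∀ K t, |t| ≤ l₀ → K₀ ≤ K →
      ∫ U, Real.exp (t * obs (K + 1) U) * D.dens (K + 1) (g₀ (K + 1)) 0 U ∂fieldMeasure (F.P (K + 1)) 0 G ≤
        ∑ τ ∈ T K, A' K t τ)
    {c₀ n₁ : ℝ} (hc₀ : 0 < c₀) (hfloor : ∀ K, K₀ ≤ K → c₀ ≤ smallFieldMass D K (g₀ K))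
    (hfloor' : ∀ K, K₀ ≤ K → c₀ ≤ smallFieldMass D (K + 1) (g₀ (K + 1)))
    (hsites : ∀ K, K₀ ≤ K → ((D.C ⟨K, F.m, g₀ K⟩).numSites K : ℝ) ≤ n₁)
    (hsites' : ∀ K, K₀ ≤ K → ((D.C ⟨K + 1, F.m, g₀ (K + 1)⟩).numSites (K + 1) : ℝ) ≤ n₁)
    (hNup : 0 ≤ Nup) (hnup : ∀ K t, |t| ≤ l₀ → K₀ ≤ K → 0 ≤ nup K t ∧ nup K t ≤ Nup)
    (hmup : ∀ K t, |t| ≤ l₀ → K₀ ≤ K → 0 ≤ mup K t ∧ mup K t ≤ Nup)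
    -- the (2.5) side condition on the size function
    (R : ℕ → ℕ → ℕ) (hR : ∀ K s, s ≤ K → B14.IsRj F.L rr ((D.C ⟨K, F.m, g₀ K⟩).flow.g s) (R K s))
    -- H3, PER TERM: the live members of the terms and their reading
    (mem : ℕ → ι → Finset ((Fin d → ℕ) × Gen ε))
    (H : TermReading sh C (cellN d n F.L) Dcap Ncap jhalf K₀ R T mem)
    {Fc Rf Fc' Rf' : ℕ → Finset (BSlot (Fin d → ℕ) PEv) → ℝ}
    (hprice : ∀ K t, |t| ≤ l₀ → K₀ ≤ K → ∀ τ ∈ badTerms mem jhalf T K,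
      Fc K (bstrOf sh mem K τ) * Rf K (bstrOf sh mem K τ) ≤
        ∏ q ∈ mem K τ, priceT sh C ((F.L : ℝ) ^ d) R (fun K => (D.C ⟨K, F.m, g₀ K⟩).flow.g) K q)
    (hprice' : ∀ K t, |t| ≤ l₀ → K₀ ≤ K → ∀ τ ∈ badTerms mem jhalf T K,
      Fc' K (bstrOf sh mem K τ) * Rf' K (bstrOf sh mem K τ) ≤
        ∏ q ∈ mem K τ, priceT sh C ((F.L : ℝ) ^ d) R (fun K => (D.C ⟨K, F.m, g₀ K⟩).flow.g) K q)
    -- H3: the remaining `Regeneration` numerator readings, over the DEFINED classes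
    (up : ∀ K t, |t| ≤ l₀ → K₀ ≤ K → ∀ c ∈ badClasses sh mem jhalf T K, ∀ τ ∈ fibre (bstrOf sh mem) T K c,
      A K t τ ≤ dead K t τ * Fc K c * nup K t)
    (dead_nonneg : ∀ K t, |t| ≤ l₀ → K₀ ≤ K → ∀ c ∈ badClasses sh mem jhalf T K,
      ∀ τ ∈ fibre (bstrOf sh mem) T K c, 0 ≤ dead K t τ)
    (resum : ∀ K t, |t| ≤ l₀ → K₀ ≤ K → ∀ c ∈ badClasses sh mem jhalf T K,
      ∑ τ ∈ fibre (bstrOf sh mem) T K c, dead K t τ ≤ Rf K c)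
    (F_nonneg : ∀ K t, |t| ≤ l₀ → K₀ ≤ K → ∀ c ∈ badClasses sh mem jhalf T K, 0 ≤ Fc K c)
    (up' : ∀ K t, |t| ≤ l₀ → K₀ ≤ K → ∀ c ∈ badClasses sh mem jhalf T K, ∀ τ ∈ fibre (bstrOf sh mem) T K c,
      A' K t τ ≤ dead' K t τ * Fc' K c * mup K t)
    (dead'_nonneg : ∀ K t, |t| ≤ l₀ → K₀ ≤ K → ∀ c ∈ badClasses sh mem jhalf T K,
      ∀ τ ∈ fibre (bstrOf sh mem) T K c, 0 ≤ dead' K t τ)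
    (resum' : ∀ K t, |t| ≤ l₀ → K₀ ≤ K → ∀ c ∈ badClasses sh mem jhalf T K,
      ∑ τ ∈ fibre (bstrOf sh mem) T K c, dead' K t τ ≤ Rf' K c)
    (F'_nonneg : ∀ K t, |t| ≤ l₀ → K₀ ≤ K → ∀ c ∈ badClasses sh mem jhalf T K, 0 ≤ Fc' K c)
    -- the seam's other inputs
    (hSh : ShellWeightBound l₀ T A A' shA shB Wsh)
    (hTB : ReindexedBudget l₀ vol T (fun K t τ => A K t τ - shA K t τ) (fun K t τ => A' K t τ - shB K t τ)
      (badOfClass (bstrOf sh mem) T (fun K _ => badClasses sh mem jhalf T K)) Cc Rr CcRec RrRec ν u s₂ q₀ r s)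
    (hr : Summable r) (hu : Summable u) (hs : Summable s) (hs₂ : Summable s₂) :
    ∃ K₁ K₂, K₀ ≤ K₁ ∧ HybridNE7 l₀ vol (fun K => T (K₁ + (K₂ + K))) (fun K => A (K₁ + (K₂ + K)))
      (fun K => A' (K₁ + (K₂ + K)))
      (fun K => badOfClass (bstrOf sh mem) T (fun K _ => badClasses sh mem jhalf T K) (K₁ + (K₂ + K)))
      (fun K => constOf l₀ B (max (em g) 0) n₁ c₀ Nup *
        recordsBudget (birthMass C) C.κ₁ ((n : ℝ) ^ d) ((F.L : ℝ) ^ d) (Real.log 2) jhalf (K₁ + (K₂ + K)))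
      (fun K => shA (K₁ + (K₂ + K))) (fun K => shB (K₁ + (K₂ + K))) (fun K => Wsh (K₁ + (K₂ + K)))
      (fun K => (r (K₁ + (K₂ + K)) + u (K₁ + (K₂ + K))) + (s (K₁ + (K₂ + K)) + s₂ (K₁ + (K₂ + K)))) := by
  have hLpos : (0 : ℝ) < F.L := by exact_mod_cast (lt_of_lt_of_le (by norm_num) (two_le_L F))
  have hΛ : (0 : ℝ) ≤ (F.L : ℝ) ^ d := pow_nonneg hLpos.le d
  exact hybridNE7_of_treeBinders_canonH D sh h hμ d n Dcap Ncap hκ₁ hE₀ hb hlo hhi hγ hγβ S hp₀ hrr ht hir hsign hcor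
    hγB hobs hbd hα hα' hc₀ hfloor hfloor' hsites hsites' hNup hnup hmup
    (π := bstrOf sh mem) (Bad' := fun K _ => badClasses sh mem jhalf T K)
    (fun K _ _ _ => badClasses_subset_classIndex sh mem jhalf T K) up dead_nonneg resum F_nonneg up' dead'_nonneg
    resum' F'_nonneg R hR (yT sh C ((F.L : ℝ) ^ d) R (fun K => (D.C ⟨K, F.m, g₀ K⟩).flow.g) mem jhalf T)
    (fun K j _ z _ Gs _ => yT_nonneg hΛ K j z Gs)
    (fun K hK j hj z hz Gs hGs => hlabT_of_termReading H (canonFam Dcap Ncap) K hK j hj z hz Gs hGs)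
    (fun _ c => c) (fun K t _ _ => Set.injOn_id _)
    (fun K t _ hK c hc => hstr_of_termReading H K hK hc)
    (fun K t ht hK => hF_of_priceReading H hΛ hprice K t ht hK)
    (fun K t ht hK => hF_of_priceReading H hΛ hprice' K t ht hK) hSh hTB hr hu hs hs₂

end End

end

end Summit.QuantumFields.BalabanUV.T4Continuum.HistoryAssemblyShapeFree
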